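import Summits.QuantumFields.YangMills.Theorems.BalabanUVNodesN15DefectKernelHk163
import Summits.QuantumFields.YangMills.Theorems.BalabanUVNodesN15DefectKernelPiece
import Literature.MathematicalPhysics.QuantumFieldTheory.King1986.MinimizerBlockDecay
import HarnessLib

/-!
# Route «BalabanUVNodes» (K4 «SpineRates»), node N15 = NE2, THE -a ∕ -b INTERFACE OF THE BACKGROUND LAYER, part 9: THE VECTOR SINGLE-SCALE
# PIECE `H_k·C^{(k)}·(w·H_kᵀ)` OF THE `U = 1` LANDAU-GAUGE PROPAGATOR — King's (4.42)–(4.43) mechanism with Bałaban's (1.63) and (2.156) BY NAME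

Cell `pub-ymgap`, seat `pub-ymgap-dag-n15-a` (KNIT-BY-NAME, generation g3; HUMAN RULING D-0062; chair R424 venue; `bears_on: R4∕N15`).  Filed
`--supports stmt-QuantumFields-19351` (helper).  THEOREMS ONLY; imports BY NAME, nothing in the tree modified: part 8 `…DefectKernelHk163` (this seat
g3: `hasMaj_idef_hk163`, `norm_HkOp_kingPair_sub_le`, `blockOf_bpt_king`, `tdistT_eq_torusSupNorm_rep`), parts 1∕3∕4∕5 (g2: `hasMaj_ofBlocks_of_entry_le`,
`hasMaj_idef_id_id_of_rate`, `hasMaj_idef_transpose_of_pairedRate`, `card_fibre_kingProj`), the defect calculus `T4EtaRateDefect.idef_comp_majorant`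
(pv25), `B9SectDWeightedNeumann` (`WRow`, `wrow_of_exp`, `hasMaj_comp_wrow`), the b05 lineage `B5Hk163Torus` (`HkOp`, `norm_HkOp_le`), the t4-ne2 ∕ b06
lineage `T4Cov2156Rate` (`cov2156_pair_torus`, `cov2156_rate_torus_king`) over `B6Cov2156Torus.bondReductionT … .cov` = [B6] (2.156)
`C^{(k)}_T = C(C*Δ_kC)⁻¹C*`, `King1986.MinimizerBlockDecay` (`blockOf_over`).

WHY (NODE-TABLE row n15, -a lane «vector layer by the scalar template»; g2 HANDOFF §g2.3 (a) «with (1.63)'s two-lattice rate, parts 1∕3∕4∕5's pattern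
gives the vector single-scale piece»).  Parts 5–7b assembled King's SCALAR `A = 0` single-scale piece `(a_kG_kQ_k^*)·C^{(k)}·(Q_kG_k)` in binder (a)'s
format.  THIS FILE is the VECTOR sibling for Bałaban's `U = 1` Landau-gauge objects on the b05∕b06 torus model: `H = H_k` of (1.63) (unit-lattice
1-forms → fine 1-forms, the typed `HkOp (L^k) M`, real parts), `C = C^{(k)}_T` of (2.156) (unit bonds → unit bonds), `K = w·H_kᵀ` (Riemann-weighted
transpose), against their `η′ = L^{−m}η` twins `H_{k+m}`, `C^{(k+m)}`, `(w∕L^{m(d+1)})·H_{k+m}ᵀ`, through King's pairing of fine bonds — with EVERY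
analytic input a tree theorem BY NAME: the H-defect (part 8, rate `L^{−k}`, decay in King's unit-torus block distance), the uniform decay of `H`
(`B5Hk163Torus.norm_HkOp_le`), the C-defect (`cov2156_rate_torus_king`, King's (4.38) shape `C′L^{−k}e^{−δ′ρ}`) and the uniform decay of `C`
(`cov2156_pair_torus`).  Binders left: the [B6] carrier ((2.54), `d ≥ 0`, symmetry, (2.61)), the site assignments of unit∕fine bonds with their block
counts, King's pairing, the operators read off by their ENTRIES (`hH`, `hH′`, `hK`, `hK′`, `hC`, `hC′` — the last two through ANY indexing `e` of the
unit bonds by b06's box indices), the two unit-torus dominances, the rate window.  ALL THREE replacement errors carry the rate `L^{−k}` (no `γ∕2` loss: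
part 8's rate comes with its own decay).

THE PRINT (objects and mechanism only; NO η-rate of (1.63) or (2.156) is printed — nothing printed is a hypothesis).  King CMP **102** (1986) p. 675
(4.42)–(4.43) «We now replace a_{j+n}Q_{j+n}G^{η′}_{j+n}(w, y′) by a_jQ_jG^η_j(w, y) in (4.42); … Clearly we can replace a_{j+n}G^{η′}_{j+n}Q*_{j+n}(x′z) by
a_jG^η_jQ*_j(x, z), and C^{(j+n),L^jη}(z, w) by C^{(j),L^jη}(z, w), and bound the error in the same way.» (the MECHANISM = `idef_comp_majorant` twice);
[Balaban1984PropagatorsI] (1.63) p. 28, [Balaban1984PropagatorsII] (2.156) p. 250 (the OBJECTS).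

CONTENTS.  §1 `kingBlockOf_bpt`, `norm_HkOp_le_tdistT` (the uniform decay of `H_k`'s entries in King's unit-torus block distance, from `norm_HkOp_le`),
`card_fibre_bondPair` (the bond pairing has the fibres of the site pairing).  §2 **`hasMaj_idef_vectorPiece`** — THE ASSEMBLY: `∃ B₀ C′ δ′ > 0` (the (2.156)
lineage's decay constant, rate constant and dominance rate) such that for every unit torus `Π ℤ∕M_ν` with `L ∣ M_ν` (`L ≥ 1`, `d + 1 ≥ 2`), levels `k`,
`m ≥ 1`: `𝔇(H′C′K′, HCK)` through (pull, pull) has the block majorant `[nΩc₀c_r·(m₀ε_K + nΩR_Cc_r·a_K) + nΩR_Hc_r·m₀·a_K]·e^{−ρd(y,y′)}` with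
`c₀ = MG163·periodConst`, `R_H = C_H∕L^k` (part 8), `R_C = C′L^{−k}`, `m₀ = nΩB₀c_r`, `ε_K = n_ηwR_H`, `a_K = n_ηwc₀`, window `ρ + σ_r ≤ δ`, `ρ + σ_r ≤ δ_C`.

HONEST FRAMING ∕ LIMITS.  `U = 1` LINEAR theory on FINITE tori (b05∕b06 torus model), dimension `d + 1 ≥ 2`, constants crude and dimension∕`L`-only;
ONE single-scale piece in the SHAPE of King's (4.42) with Bałaban's vector factors — NOT Bałaban's multiscale random-walk expansion of `G_k(Ω)` ([B6]
Sect. 2, NODE 00's object), NOT the telescoping over `j` ∕ the `j = 0` piece ∕ the `(L^jη)^{2−d}` prefactor (`King1986.SingleScaleRate`), nothing with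
background (`U ≠ 1` = NE2⁺ proper, NOT PRINTED ∕ not proved); count-neutral (typed 28∕28 · discharged unchanged); NOT a discharge of N15; one finite
T⁴ at fixed ε — NOT infinite volume, NOT OS on ℝ⁴, NOT a mass gap, NOT Clay.
-/

noncomputable section

open scoped BigOperators
open Finset

namespace Summit.QuantumFields.YangMills.BalabanUVNodes.N15.DefectKernel

open Literature.MathematicalPhysics.QuantumFieldTheory.Balaban1983to89
open Literature.MathematicalPhysics.QuantumFieldTheory.Balaban1983to89.B11SectG (BlockNorm HasMaj RowSum)
open Literature.MathematicalPhysics.QuantumFieldTheory.Balaban1983to89.T4EtaRateDefect (idef idef_comp_majorant slowWeight_const)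
open Literature.MathematicalPhysics.QuantumFieldTheory.Balaban1983to89.T4EtaRateCoeffDefect (pull fibre mem_fibre)
open Literature.MathematicalPhysics.QuantumFieldTheory.Balaban1983to89.B9SectDWeightedNeumann (WRow wrow_of_exp hasMaj_comp_wrow)
open Literature.MathematicalPhysics.QuantumFieldTheory.Balaban1983to89.B6RandomWalk (Triangle254)
open Literature.MathematicalPhysics.QuantumFieldTheory.Balaban1983to89.B4TorusKernel (periodConst)
open Literature.MathematicalPhysics.QuantumFieldTheory.Balaban1983to89.B5Prop11Plancherel (Tor fine)
open Literature.MathematicalPhysics.QuantumFieldTheory.Balaban1983to89.B5Block118 (bpt)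
open Literature.MathematicalPhysics.QuantumFieldTheory.Balaban1983to89.B5Blocks16 (bpt_val bpt_bijective)
open Literature.MathematicalPhysics.QuantumFieldTheory.Balaban1983to89.B5Hk163Strip (kappa163 kappa163_pos)
open Literature.MathematicalPhysics.QuantumFieldTheory.Balaban1983to89.B5Hk163Decay (MG163)
open Literature.MathematicalPhysics.QuantumFieldTheory.Balaban1983to89.B5Hk163Torus (HkOp norm_HkOp_le)
open Literature.MathematicalPhysics.QuantumFieldTheory.Balaban1983to89.B5Hk163TorusHolderDecay (MD163)
open Literature.MathematicalPhysics.QuantumFieldTheory.Balaban1983to89.T4Hk163StripRate (CGe)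
open Literature.MathematicalPhysics.QuantumFieldTheory.Balaban1983to89.B6LowerBound2153Torus (toT rep toT_rep)
open Literature.MathematicalPhysics.QuantumFieldTheory.Balaban1983to89.B6Lemma24Torus (pbox)
open Literature.MathematicalPhysics.QuantumFieldTheory.Balaban1983to89.B6BondEliminationTorus (pdist)
open Literature.MathematicalPhysics.QuantumFieldTheory.Balaban1983to89.B6Cov2156Torus (deltaPol bondReductionT one_le_M)
open Literature.MathematicalPhysics.QuantumFieldTheory.Balaban1983to89.T4Cov2156Rate (cov2156_pair_torus cov2156_rate_torus_king
  bondDist_nonneg)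
open Literature.MathematicalPhysics.QuantumFieldTheory.King1986 (exp_decay_mono)
open Literature.MathematicalPhysics.QuantumFieldTheory.King1986.Torus (blockOf val_blockOf tdistT tdistT_symm blockOf_over)

variable {d : ℕ}

/-! ## §1 The uniform decay of `H_k`'s entries in King's unit-torus block distance; the fibres of the bond pairing -/

section Inputs

variable (n : ℕ) [NeZero n] (M : Fin (d + 1) → ℕ) [hM : ∀ μ, NeZero (M μ)]

/-- King's unit block of a fine point in block coordinates at one level: `B(n·y′ + a) = y′`. [folklore] -/
theorem kingBlockOf_bpt (y' : Tor M) (a : Fin (d + 1) → Fin n) : blockOf n M (bpt n M y' a) = y' := by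
  have hn : 0 < n := Nat.pos_of_ne_zero (NeZero.ne n)
  funext ν
  apply ZMod.val_injective
  rw [val_blockOf, bpt_val, Nat.mul_add_div hn, Nat.div_eq_of_lt (a ν).isLt, add_zero]

/-- **THE UNIFORM DECAY OF `H_k`'s ENTRIES IN KING'S CURRENCY** (`B5Hk163Torus.norm_HkOp_le` read through `tdistT_eq_torusSupNorm_rep`): for every
fine point `x`, unit point `y` and directions, `‖H_n((x, μ), (y, λ))‖ ≤ MG163(d+1)·periodConst(κ₁₆₃(d+1), d)·e^{−(κ₁₆₃(d+1)∕(d+1))·|B(x) − y|_{T₁}}`,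
uniformly in the volume and in `n` — Theorem-3.3's role for the vector piece, a tree theorem. [cite: Balaban1984PropagatorsI, (1.63) p.28, p.38 (decay method)] -/
theorem norm_HkOp_le_tdistT (μ lam : Fin (d + 1)) (x : Tor (fine n M)) (y : Tor M) :
    ‖HkOp n M (x, μ) (y, lam)‖ ≤ MG163 (d + 1) * periodConst (kappa163 (d + 1)) d *
      Real.exp (-(kappa163 (d + 1) / (d + 1) * tdistT M (blockOf n M x) y)) := by
  obtain ⟨⟨y', a⟩, hx⟩ := (bpt_bijective n M).2 x
  simp only at hx
  subst hx
  rw [kingBlockOf_bpt, tdistT_eq_torusSupNorm_rep]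
  have h := norm_HkOp_le n M μ lam a (rep M y') (rep M y)
  rwa [toT_rep, toT_rep] at h

/-- The bond pairing `prV (x′, μ) = (pr x′, μ)` has the fibres of the site pairing: `#prV⁻¹(x, μ) = #pr⁻¹(x)`. [folklore] -/
theorem card_fibre_bondPair {X X' I : Type} [Fintype X'] [DecidableEq X] [Fintype I] [DecidableEq I] [DecidableEq X']
    (pr : X' → X) (prV : X' × I → X × I) (hprV : ∀ i, prV i = (pr i.1, i.2)) (x : X) (μ : I) :
    (fibre prV (x, μ)).card = (fibre pr x).card := by
  have h : fibre prV (x, μ) = (fibre pr x).map ⟨fun x' => (x', μ), fun a b hab => (Prod.mk.inj hab).1⟩ := by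
    ext ⟨x', ν⟩
    simp only [mem_fibre, hprV, Prod.mk.injEq, Finset.mem_map, Function.Embedding.coeFn_mk]
    constructor
    · rintro ⟨h1, h2⟩; exact ⟨x', h1, rfl, h2.symm⟩
    · rintro ⟨a, ha, rfl, rfl⟩; exact ⟨ha, rfl⟩
  rw [h, Finset.card_map]

end Inputs

/-! ## §2 The assembly: the vector single-scale piece in binder (a)'s format -/

section Piece

/-- **THE VECTOR SINGLE-SCALE PIECE `𝔇(H′C′K′, HCK)` IN BINDER (a)'s FORMAT, EVERY ANALYTIC INPUT A TREE THEOREM.**  For `d + 1 ≥ 2` and `L ≥ 1` there are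
`B₀, C′, δ′ > 0` (the (2.156) lineage's: `cov2156_pair_torus`, `cov2156_rate_torus_king`) such that for every unit torus `Π ℤ∕M_ν` with `L ∣ M_ν`, all levels
`k` and `m ≥ 1`, Bałaban's typed `H_k = HkOp (L^k) M`, `H_{k+m} = HkOp (L^mL^k) M` read off as real linear maps by their entries (`hH`, `hH′`), their
Riemann-weighted transposes `K = w·H_kᵀ`, `K′ = (w∕(L^m)^{d+1})·H_{k+m}ᵀ` (`hK`, `hK′`, `w ≥ 0`), the (2.156) covariances `C^{(k)}`, `C^{(k+m)}` read off by
their entries through any indexing `e` of the unit bonds by box indices (`hC`, `hC′`), King's pairing `pr`∕`prV`, ANY [B6] carrier ((2.54), `d ≥ 0`,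
symmetric, (2.61) at `σ_r` with constant `c_r`), ANY site assignments `blkΩ` of the unit bonds (count `nΩ`) and `blkη` of the fine bonds (count `n_η`)
with the H-dominance `δ·d(blkΩ b, blkη i) ≤ δ_H·|b − B(i)|_{T₁}` and the C-dominance `δ_C·d(blkΩ b, blkΩ b′) ≤ δ′·ρ_M(e b, e b′)`, and a rate `ρ ≥ 0`
with `ρ + σ_r ≤ δ`, `ρ + σ_r ≤ δ_C`: the block majorant displayed in the header (three replacement errors, each with the rate `L^{−k}`).
[cite: King1986, (4.42)–(4.43) p.675 (mechanism); Balaban1984PropagatorsI, (1.63) p.28; Balaban1984PropagatorsII, (2.156) p.250 (objects)] -/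
theorem hasMaj_idef_vectorPiece (hd : 1 ≤ d) {L : ℕ} [NeZero L] (hL : 1 ≤ L) :
    ∃ B₀ C₁ δ' : ℝ, 0 < B₀ ∧ 0 < C₁ ∧ 0 < δ' ∧ ∀ (M : Fin (d + 1) → ℕ) [∀ μ, NeZero (M μ)] (_ : ∀ i, L ∣ M i)
      (k m : ℕ) (_ : 1 ≤ m)
      -- the carrier and the site assignments
      {g : B6.Geometry} [DecidableEq g.Site] (_ : Triangle254 g) (_ : ∀ y y' : g.Site, 0 ≤ g.dist y y')
      (_ : ∀ y y' : g.Site, g.dist y y' = g.dist y' y) {σr cr : ℝ} (_ : 0 ≤ σr) (_ : RowSum g σr cr)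
      (blkΩ : Tor M × Fin (d + 1) → g.Site) {nΩ : ℕ} (_ : ∀ y', (fibre blkΩ y').card ≤ nΩ)
      (blkη : Tor (fine (L ^ k) M) × Fin (d + 1) → g.Site) {nη : ℕ} (_ : ∀ y', (fibre blkη y').card ≤ nη)
      (pr : Tor (fine (L ^ m * L ^ k) M) → Tor (fine (L ^ k) M)) (_ : ∀ x' μ, (pr x' μ).val = (x' μ).val / L ^ m)
      (prV : Tor (fine (L ^ m * L ^ k) M) × Fin (d + 1) → Tor (fine (L ^ k) M) × Fin (d + 1))
      (_ : ∀ i, prV i = (pr i.1, i.2))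
      -- Bałaban's operators, read off by their entries
      (H : (Tor M × Fin (d + 1) → ℝ) →ₗ[ℝ] (Tor (fine (L ^ k) M) × Fin (d + 1) → ℝ))
      (_ : ∀ b i, H (Pi.single b 1) i = (HkOp (L ^ k) M i b).re)
      (H' : (Tor M × Fin (d + 1) → ℝ) →ₗ[ℝ] (Tor (fine (L ^ m * L ^ k) M) × Fin (d + 1) → ℝ))
      (_ : ∀ b i, H' (Pi.single b 1) i = (HkOp (L ^ m * L ^ k) M i b).re)
      {w : ℝ} (_ : 0 ≤ w) (K : (Tor (fine (L ^ k) M) × Fin (d + 1) → ℝ) →ₗ[ℝ] (Tor M × Fin (d + 1) → ℝ))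
      (_ : ∀ i b, K (Pi.single i 1) b = w * H (Pi.single b 1) i)
      (K' : (Tor (fine (L ^ m * L ^ k) M) × Fin (d + 1) → ℝ) →ₗ[ℝ] (Tor M × Fin (d + 1) → ℝ))
      (_ : ∀ i' b, K' (Pi.single i' 1) b = w / ((L : ℝ) ^ m) ^ (d + 1) * H' (Pi.single b 1) i')
      (e : Tor M × Fin (d + 1) → B4.Idx (pbox M) (d + 1))
      (C : (Tor M × Fin (d + 1) → ℝ) →ₗ[ℝ] (Tor M × Fin (d + 1) → ℝ))
      (_ : ∀ b b', C (Pi.single b' 1) b = (bondReductionT L M (deltaPol M (L ^ k))).cov (e b) (e b'))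
      (C' : (Tor M × Fin (d + 1) → ℝ) →ₗ[ℝ] (Tor M × Fin (d + 1) → ℝ))
      (_ : ∀ b b', C' (Pi.single b' 1) b = (bondReductionT L M (deltaPol M (L ^ (k + m)))).cov (e b) (e b'))
      -- the two unit-torus dominances (the consumer's reading of its site assignments)
      {δ : ℝ} (_ : ∀ (b : Tor M × Fin (d + 1)) (i : Tor (fine (L ^ k) M) × Fin (d + 1)),
        δ * g.dist (blkΩ b) (blkη i) ≤ kappa163 (d + 1) / (d + 1) * tdistT M b.1 (blockOf (L ^ k) M i.1))
      {δC : ℝ} (_ : ∀ b b' : Tor M × Fin (d + 1),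
        δC * g.dist (blkΩ b) (blkΩ b') ≤ δ' * pdist M (one_le_M M) ((e b).1 : Fin (d + 1) → ℤ) ((e b').1 : Fin (d + 1) → ℤ))
      -- the rate window
      {ρ : ℝ} (_ : 0 ≤ ρ) (_ : ρ + σr ≤ δ) (_ : ρ + σr ≤ δC),
      HasMaj (BlockNorm.ofBlocks g blkη) (BlockNorm.ofBlocks g (blkη ∘ prV))
        (idef (pull prV) (pull prV) (H' ∘ₗ (C' ∘ₗ K')) (H ∘ₗ (C ∘ₗ K)))
        (fun y y' =>
          (nΩ * (MG163 (d + 1) * periodConst (kappa163 (d + 1)) d) * cr *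
              (nΩ * B₀ * cr *
                  (nη * w * ((CGe (d + 1) + (d + 1) * MD163 (d + 1)) * periodConst (kappa163 (d + 1)) d / ((L ^ k : ℕ) : ℝ)))
                + nΩ * (C₁ * ((L : ℝ) ^ k)⁻¹) * cr * (nη * w * (MG163 (d + 1) * periodConst (kappa163 (d + 1)) d)))
            + nΩ * ((CGe (d + 1) + (d + 1) * MD163 (d + 1)) * periodConst (kappa163 (d + 1)) d / ((L ^ k : ℕ) : ℝ)) * cr *
              (nΩ * B₀ * cr * (nη * w * (MG163 (d + 1) * periodConst (kappa163 (d + 1)) d)))) *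
          Real.exp (-(ρ * g.dist y y'))) := by
  have hd1 : 2 ≤ d + 1 := by omega
  obtain ⟨B₀, δ₀, hB₀, hδ₀, HP⟩ := cov2156_pair_torus (d := d + 1) hd1 hL
  obtain ⟨C₁, δ₁, hC₁, hδ₁, HR⟩ := cov2156_rate_torus_king (d := d + 1) hd1 hL
  refine ⟨B₀, C₁, min δ₀ δ₁, hB₀, hC₁, lt_min hδ₀ hδ₁, ?_⟩
  intro M _ hLM k m hm g _ htri hdist hsymm σr cr hσr hrow blkΩ nΩ hnΩ blkη nη hnη pr hpr prV hprV H hH H' hH' w hw0 K hK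
    K' hK' e C hC C' hC' δ hdomH δC hdomC ρ hρ hρ₁ hρ₂
  -- names for the constants
  set c₀ : ℝ := MG163 (d + 1) * periodConst (kappa163 (d + 1)) d with hc₀def
  set RH : ℝ := (CGe (d + 1) + (d + 1) * MD163 (d + 1)) * periodConst (kappa163 (d + 1)) d / ((L ^ k : ℕ) : ℝ) with hRHdef
  set RC : ℝ := C₁ * ((L : ℝ) ^ k)⁻¹ with hRCdef
  have hc₀ : 0 ≤ c₀ := by
    -- `c₀ = MG163·periodConst ≥ 0`: read off `norm_HkOp_le_tdistT` at any entry
    have h1 := (norm_nonneg _).trans (norm_HkOp_le_tdistT (L ^ k) M 0 0 (0 : Tor (fine (L ^ k) M)) (0 : Tor M))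
    have hE := Real.exp_pos (-(kappa163 (d + 1) / (d + 1) * tdistT M (blockOf (L ^ k) M 0) 0))
    nlinarith
  have hRH0 : 0 ≤ RH := by
    -- `R_H ≥ 0`: read off part 8's rate theorem at any entry
    have h1 := (norm_nonneg _).trans
      (norm_HkOp_kingPair_sub_le (L ^ m) (L ^ k) M pr hpr 0 0 (0 : Tor (fine (L ^ m * L ^ k) M)) (0 : Tor M))
    have hE := Real.exp_pos (-(kappa163 (d + 1) / (d + 1) * tdistT M (blockOf (L ^ m * L ^ k) M 0) 0))
    nlinarith
  have hRC0 : 0 ≤ RC := mul_nonneg hC₁.le (inv_nonneg.mpr (pow_nonneg (Nat.cast_nonneg _) _))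
  have hnηw : 0 ≤ (nη : ℝ) * w := mul_nonneg (Nat.cast_nonneg _) hw0
  -- the H-legs: uniform decay (Theorem-3.3's role) in the carrier, from §1 and the H-dominance
  have hdecH : ∀ (b : Tor M × Fin (d + 1)) (i : Tor (fine (L ^ k) M) × Fin (d + 1)),
      |H (Pi.single b 1) i| ≤ c₀ * Real.exp (-(δ * g.dist (blkΩ b) (blkη i))) := fun b i => by
    rw [hH]
    refine (Complex.abs_re_le_norm _).trans ((norm_HkOp_le_tdistT (L ^ k) M i.2 b.2 i.1 b.1).trans ?_)
    refine mul_le_mul_of_nonneg_left (Real.exp_le_exp.mpr ?_) hc₀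
    have := hdomH b i
    rw [tdistT_symm] at this
    linarith
  have hdecH' : ∀ (b : Tor M × Fin (d + 1)) (i' : Tor (fine (L ^ m * L ^ k) M) × Fin (d + 1)),
      |H' (Pi.single b 1) i'| ≤ c₀ * Real.exp (-(δ * g.dist (blkΩ b) (blkη (prV i')))) := fun b i' => by
    rw [hH']
    refine (Complex.abs_re_le_norm _).trans ((norm_HkOp_le_tdistT (L ^ m * L ^ k) M i'.2 b.2 i'.1 b.1).trans ?_)
    refine mul_le_mul_of_nonneg_left (Real.exp_le_exp.mpr ?_) hc₀
    have h1 := hdomH b (prV i')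
    simp only [hprV] at h1
    rw [tdistT_symm, ← blockOf_over M (pr i'.1) i'.1 (hpr i'.1)] at h1
    simp only [hprV]
    linarith
  -- (i) the undifferenced COARSE adjoint factor `K`: `a_K·e^{−ρd}`, `a_K = n_η w c₀`
  have hδρ : ρ ≤ δ := by linarith
  have hKmaj : HasMaj (BlockNorm.ofBlocks g blkη) (BlockNorm.ofBlocks g blkΩ) K
      (fun y y' => nη * w * c₀ * Real.exp (-((ρ + 0) * g.dist y y'))) := by
    have key := hasMaj_ofBlocks_of_entry_le blkη blkΩ (T := K)
      (κ := fun y y' => w * c₀ * Real.exp (-(ρ * g.dist y y')))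
      (fun _ _ => mul_nonneg (mul_nonneg hw0 hc₀) (Real.exp_nonneg _)) hnη fun b i => by
        rw [hK, abs_mul, abs_of_nonneg hw0, mul_assoc]
        refine mul_le_mul_of_nonneg_left ((hdecH b i).trans ?_) hw0
        rw [hsymm]
        exact exp_decay_mono hc₀ hδρ (hdist _ _)
    refine key.mono fun y y' => le_of_eq ?_
    rw [add_zero]; ring
  have hKmaj' : HasMaj (BlockNorm.ofBlocks g blkη) (BlockNorm.ofBlocks g blkΩ) K
      (fun y y' => nη * w * c₀ * Real.exp (-(ρ * g.dist y y'))) := by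
    simpa only [add_zero] using hKmaj
  -- (ii) the DEFECT of the adjoint factor (part 4's transpose mechanism + part 8's paired rate): `ε_K·e^{−ρd}·1`, `ε_K = n_η w R_H`
  have hw' : 0 ≤ w / ((L : ℝ) ^ m) ^ (d + 1) := div_nonneg hw0 (pow_nonneg (pow_nonneg (Nat.cast_nonneg _) _) _)
  have hbal : ∀ i : Tor (fine (L ^ k) M) × Fin (d + 1), w / ((L : ℝ) ^ m) ^ (d + 1) * ((fibre prV i).card : ℝ) = w := by
    rintro ⟨x, μ⟩
    rw [card_fibre_bondPair pr prV hprV x μ]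
    exact king_weight_balance L k m M pr hpr w x
  have hDK : HasMaj (BlockNorm.ofBlocks g blkη) (BlockNorm.ofBlocks g blkΩ) (idef (pull prV) LinearMap.id K' K)
      (fun y y' => nη * w * RH * Real.exp (-(ρ * g.dist y y')) * (fun _ : g.Site => (1 : ℝ)) y') := by
    have key := hasMaj_idef_transpose_of_pairedRate blkη blkΩ hnη prV hw0 hw' hK hK' hbal
      (κ := fun y y' => RH * Real.exp (-(ρ * g.dist y y'))) (fun _ _ => mul_nonneg hRH0 (Real.exp_nonneg _))
      fun b i' => by
        have h1 := hdomH b (prV i')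
        simp only [hprV] at h1 ⊢
        rw [tdistT_symm, ← blockOf_over M (pr i'.1) i'.1 (hpr i'.1)] at h1
        rw [hH', hH, ← Complex.sub_re]
        refine (Complex.abs_re_le_norm _).trans
          ((norm_HkOp_kingPair_sub_le (L ^ m) (L ^ k) M pr hpr i'.2 b.2 i'.1 b.1).trans ?_)
        refine mul_le_mul_of_nonneg_left (Real.exp_le_exp.mpr ?_) hRH0
        have h2 : ρ * g.dist (blkΩ b) (blkη (pr i'.1, i'.2)) ≤ δ * g.dist (blkΩ b) (blkη (pr i'.1, i'.2)) :=
          mul_le_mul_of_nonneg_right hδρ (hdist _ _)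
        linarith
    refine key.mono fun y y' => le_of_eq ?_
    ring
  -- (iii) the DEFECT of the covariance ((2.156) rate, identity pairing): `N_C·1`, `N_C = nΩ R_C e^{−δ_C d}`, `‖N_C‖_ρ ≤ nΩ R_C c_r`
  have hDC : HasMaj (BlockNorm.ofBlocks g blkΩ) (BlockNorm.ofBlocks g blkΩ) (idef LinearMap.id LinearMap.id C' C)
      (fun y y' => nΩ * RC * Real.exp (-(δC * g.dist y y')) * (fun _ : g.Site => (1 : ℝ)) y') := by
    have key := hasMaj_idef_id_id_of_rate blkΩ hnΩ C' C (t := fun b b' =>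
        pdist M (one_le_M M) ((e b).1 : Fin (d + 1) → ℤ) ((e b').1 : Fin (d + 1) → ℤ)) hRC0 hdomC fun b b' => by
      rw [hC', hC]
      exact (HR M hLM k m (e b) (e b')).trans
        (exp_decay_mono hRC0 (min_le_right _ _) (bondDist_nonneg (one_le_M M) _ _))
    exact key.mono fun y y' => le_of_eq (by rw [mul_one])
  have hNC_wrow : WRow g ρ (fun y y' => nΩ * RC * Real.exp (-(δC * g.dist y y'))) (nΩ * RC * cr) :=
    wrow_of_exp hdist hrow (mul_nonneg (Nat.cast_nonneg _) hRC0) hρ₂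
  -- (iv) the undifferenced covariances `C`, `C′`: `N₀ = nΩ B₀ e^{−δ_C d}`, `‖N₀‖_ρ ≤ nΩ B₀ c_r`
  have hCov : ∀ {kk : ℕ} {T : (Tor M × Fin (d + 1) → ℝ) →ₗ[ℝ] (Tor M × Fin (d + 1) → ℝ)},
      (∀ b b', T (Pi.single b' 1) b = (bondReductionT L M (deltaPol M (L ^ kk))).cov (e b) (e b')) →
      HasMaj (BlockNorm.ofBlocks g blkΩ) (BlockNorm.ofBlocks g blkΩ) T
        (fun y y' => nΩ * (B₀ * Real.exp (-(δC * g.dist y y')))) := by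
    intro kk T hT
    refine hasMaj_ofBlocks_of_entry_le blkΩ blkΩ (κ := fun y y' => B₀ * Real.exp (-(δC * g.dist y y')))
      (fun _ _ => mul_nonneg hB₀.le (Real.exp_nonneg _)) hnΩ fun b b' => ?_
    rw [hT]
    refine ((HP M hLM kk (e b) (e b')).1).trans ?_
    refine (exp_decay_mono hB₀.le (min_le_left δ₀ δ₁) (bondDist_nonneg (one_le_M M) _ _)).trans ?_
    exact mul_le_mul_of_nonneg_left (Real.exp_le_exp.mpr (by linarith [hdomC b b'])) hB₀.le
  have hCmaj := hCov (kk := k) (T := C) hC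
  have hC'maj := hCov (kk := k + m) (T := C') hC'
  have hN₀ : ∀ y y' : g.Site, 0 ≤ nΩ * (B₀ * Real.exp (-(δC * g.dist y y'))) := fun _ _ =>
    mul_nonneg (Nat.cast_nonneg _) (mul_nonneg hB₀.le (Real.exp_nonneg _))
  have hm₀ : WRow g ρ (fun y y' => nΩ * (B₀ * Real.exp (-(δC * g.dist y y')))) (nΩ * B₀ * cr) := by
    have h := wrow_of_exp (ρ := ρ) (θ := nΩ * B₀) (δ := δC) hdist hrow (mul_nonneg (Nat.cast_nonneg _) hB₀.le) hρ₂
    exact h.mono fun y y' => le_of_eq (by ring)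
  -- STEP 1: `𝔇(C′K′, CK) ≤ (m₀ ε_K + nΩ R_C c_r a_K)·e^{−ρd}`
  have step1 := idef_comp_majorant (b₁ := BlockNorm.ofBlocks g blkη) (b₂ := BlockNorm.ofBlocks g blkΩ)
    (b₂' := BlockNorm.ofBlocks g blkΩ) (b₃' := BlockNorm.ofBlocks g blkΩ)
    (τ₁ := pull prV) (τ₂ := LinearMap.id) (τ₃ := LinearMap.id) (T₁' := C') (T₂' := K') (T₁ := C) (T₂ := K)
    (w := fun _ => (1 : ℝ)) (σ := 0) (C := 1)
    htri hρ (fun _ => zero_le_one) (slowWeight_const 1) zero_le_one (mul_nonneg hnηw hRH0)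
    (mul_nonneg hnηw hc₀) hN₀ hm₀ (fun y y' => mul_nonneg (mul_nonneg (Nat.cast_nonneg _) hRC0) (Real.exp_nonneg _))
    hNC_wrow hC'maj hDK hDC hKmaj
  -- (v) the undifferenced FINE factor `H′`: `nΩ c₀ e^{−δ d}`, `‖·‖_ρ ≤ nΩ c₀ c_r`
  have hH'maj : HasMaj (BlockNorm.ofBlocks g blkΩ) (BlockNorm.ofBlocks g (blkη ∘ prV)) H'
      (fun y y' => nΩ * (c₀ * Real.exp (-(δ * g.dist y y')))) :=
    hasMaj_ofBlocks_of_entry_le blkΩ (blkη ∘ prV) (T := H') (κ := fun y y' => c₀ * Real.exp (-(δ * g.dist y y')))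
      (fun _ _ => mul_nonneg hc₀ (Real.exp_nonneg _)) hnΩ fun i' b => by
        rw [Function.comp_apply, hsymm]
        exact hdecH' b i'
  have hH'wrow : WRow g ρ (fun y y' => nΩ * (c₀ * Real.exp (-(δ * g.dist y y')))) (nΩ * c₀ * cr) := by
    have h := wrow_of_exp (ρ := ρ) (θ := nΩ * c₀) (δ := δ) hdist hrow (mul_nonneg (Nat.cast_nonneg _) hc₀) hρ₁
    exact h.mono fun y y' => le_of_eq (by ring)
  -- (vi) the DEFECT of `H` (part 8): `nΩ R_H e^{−δ d}·1`, `‖·‖_ρ ≤ nΩ R_H c_r`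
  have hDH : HasMaj (BlockNorm.ofBlocks g blkΩ) (BlockNorm.ofBlocks g (blkη ∘ prV)) (idef LinearMap.id (pull prV) H' H)
      (fun y y' => nΩ * (RH * Real.exp (-(δ * g.dist y y'))) * (fun _ : g.Site => (1 : ℝ)) y') := by
    have key := hasMaj_idef_hk163 (L ^ m) (L ^ k) M blkΩ (blkη ∘ prV) hnΩ pr hpr prV hprV H hH H' hH' (δ := δ)
      fun i' b => by
        have h1 := hdomH b (prV i')
        simp only [hprV] at h1
        rw [tdistT_symm, ← blockOf_over M (pr i'.1) i'.1 (hpr i'.1)] at h1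
        rw [Function.comp_apply, hsymm]
        simp only [hprV]
        exact h1
    exact key.mono fun y y' => le_of_eq (by rw [hRHdef]; ring)
  have hDH_wrow : WRow g ρ (fun y y' => nΩ * (RH * Real.exp (-(δ * g.dist y y')))) (nΩ * RH * cr) := by
    have h := wrow_of_exp (ρ := ρ) (θ := nΩ * RH) (δ := δ) hdist hrow (mul_nonneg (Nat.cast_nonneg _) hRH0) hρ₁
    exact h.mono fun y y' => le_of_eq (by ring)
  -- (vii) the undifferenced COARSE product `C∘K`: `1·m₀·a_K·e^{−ρd}`
  have hCK : HasMaj (BlockNorm.ofBlocks g blkη) (BlockNorm.ofBlocks g blkΩ) (C ∘ₗ K)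
      (fun y y' => (BlockNorm.ofBlocks g blkΩ).κ * (nΩ * B₀ * cr) * (nη * w * c₀) * Real.exp (-((ρ + 0) * g.dist y y'))) := by
    have h := hasMaj_comp_wrow htri hρ (mul_nonneg hnηw hc₀) hN₀ hm₀ hCmaj hKmaj'
    simpa only [add_zero] using h
  have hκ : (BlockNorm.ofBlocks g blkΩ).κ = 1 := rfl
  have hcr0 : 0 ≤ cr := le_trans (Finset.sum_nonneg fun _ _ => (Real.exp_pos _).le) (hrow (blkΩ (0, 0)))
  have hεCK : 0 ≤ (BlockNorm.ofBlocks g blkΩ).κ * (nΩ * B₀ * cr) * (nη * w * RH)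
      + (BlockNorm.ofBlocks g blkΩ).κ * (nΩ * RC * cr) * (nη * w * c₀) * 1 := by
    rw [hκ]
    have := mul_nonneg hnηw hRH0
    have := mul_nonneg hnηw hc₀
    have := hB₀.le
    positivity
  have haCK : 0 ≤ (BlockNorm.ofBlocks g blkΩ).κ * (nΩ * B₀ * cr) * (nη * w * c₀) := by
    rw [hκ]
    have := mul_nonneg hnηw hc₀
    have := hB₀.le
    positivity
  -- STEP 2: `𝔇(H′(C′K′), H(CK))`
  have step2 := idef_comp_majorant (b₁ := BlockNorm.ofBlocks g blkη) (b₂ := BlockNorm.ofBlocks g blkΩ)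
    (b₂' := BlockNorm.ofBlocks g blkΩ) (b₃' := BlockNorm.ofBlocks g (blkη ∘ prV))
    (τ₁ := pull prV) (τ₂ := LinearMap.id) (τ₃ := pull prV) (T₁' := H') (T₂' := C' ∘ₗ K') (T₁ := H) (T₂ := C ∘ₗ K)
    (w := fun _ => (1 : ℝ)) (σ := 0) (C := 1)
    htri hρ (fun _ => zero_le_one) (slowWeight_const 1) zero_le_one hεCK haCK
    (fun y y' => mul_nonneg (Nat.cast_nonneg _) (mul_nonneg hc₀ (Real.exp_nonneg _))) hH'wrow
    (fun y y' => mul_nonneg (Nat.cast_nonneg _) (mul_nonneg hRH0 (Real.exp_nonneg _))) hDH_wrow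
    hH'maj step1 hDH hCK
  refine step2.mono fun y y' => le_of_eq ?_
  simp only [hκ]
  ring

end Piece

end Summit.QuantumFields.YangMills.BalabanUVNodes.N15.DefectKernel
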